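import Summits.QuantumFields.BalabanUV.Beta.SymmetrisedDressingKernel
import Summits.QuantumFields.BalabanUV.Beta.AxialDressingRootedBmHessian

/-!
# `BalabanUV.Beta.SymmetrisedDressingLegs` — the SYMMETRISED block-mean window operator `coProjSymAt`, the leg dressings in window form
# = the comp-form dressing `dressKSymAt`, and their same-rate bi-localisation bounds (β sub-cell, row D1 OWNER b2b-balaban-beta-an2, gen 26;
# K5a of the «JsB12Sym» wiring, memo `JSB12SYM-SPINE.v1.2` §3 K3/K4: decl-by-decl twin of `AxialDressingRootedBmLegs` with `pmBm ↦ pmSymBm`,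
# `piKBm ↦ piKSymBm`)

HONEST FRAMING (cell charter, verbatim): «discharging BetaPertH makes Balaban's UV stability UNCONDITIONAL — a real
constructive-QFT result; it is NOT the continuum limit and NOT the Clay problem.»  DERIVED cell leaf; no statement of Bałaban's papers, no
`[cite:]` tag, no `Prop` fact; instantiates no wall binder.  NOT D1, NOT `BetaPertH`; NOT continuum; NOT Clay.
HONEST DEPENDENCY: continuum YM on T⁴ ⇐ BetaPertH ∧ nine spine estimates (0/9 proved); BetaPertH ⇐ (D1) ∧ (D4) ∧ CAP+tail;
G-an2-4 gates asym, D1 and NE2/3/4.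

## What is here (decl-by-decl twins of `AxialDressingRootedBmLegs` §1–§3 with `pmBm ↦ pmSymBm`, `piKBm ↦ piKSymBm`; the window constants
`cWb`, `cKb` of the comb file are REUSED by name — `abs_pmSymBm_le` has the same bound `1 + 4·(d+1)·N` as `abs_pmBm_le`)
* §1 `coProjSymAt ρ N g α q := Σ_{v ∈ cube} Σ_β pmSymBm ρ N β (q+v) α q · g β (q+v)`, `abs_coProjSymAt_le`, `coProjSymAt_shift`.
* §2 `legCo₁SymAt`, `legCo₂SymAt` (window form), the four fibre-contraction rules of `piKSymBm`, and the identification with the comp-form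
  dressing of `SymmetrisedDressingKernel`: `legCo₁SymAt_eq_comp : legCo₁SymAt ρ N K = comp (piKSymBm ρ N) K`,
  `legCo₂SymAt_eq_comp : legCo₂SymAt ρ N K = comp K (trK (piKSymBm ρ N))`, `dressKSymAt_eq_legs : dressKSymAt ρ N K = legCo₂SymAt ρ N (legCo₁SymAt ρ N K)`.
* §3 `biLoc_legCo₁SymAt` / `biLoc_legCo₂SymAt` / `biLoc_dressKSymAt` (constant `cKb d N δ` per leg; SAME rate).
All declarations `[folklore]`/[our object]; axioms standard.  Provenance: b2b-balaban β sub-cell, unit beta-an2 gen 26, 2026-08-21.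
-/

open Finset
open scoped BigOperators
open Literature.MathematicalPhysics.QuantumFieldTheory
open Literature.MathematicalPhysics.QuantumFieldTheory.Balaban1983to89
open Literature.MathematicalPhysics.QuantumFieldTheory.Balaban1983to89.Beta
open B12Sec2to5 (l1 l1_nonneg)
open ExpKernelCalculus (MKer Decays BiLoc comp tr shiftK l1_sub_triangle l1_sub_symm)
open AffineAveraging (Form0 Form1 box toSite unitVec unitVec_apply)
open AveragingContoursRooted (ctrOff ctrOff_mem_box)
open AxialDressing (exp_recenter_le)
open OneStepResolventKernel (Fib LocStencil JetData)
open Summit.QuantumFields.BalabanUV.Beta.TameKernelCalculus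
open Summit.QuantumFields.BalabanUV.Beta.AxialDressingRooted
open Summit.QuantumFields.BalabanUV.Beta.SymmetrisedDressingMatrix
open Summit.QuantumFields.BalabanUV.Beta.SymmetrisedDressingKernel

namespace Summit.QuantumFields.BalabanUV.Beta.SymmetrisedDressingLegs

noncomputable section

variable {d : ℕ}

/-! ## §1 The block-mean window operator `coProjSymAt` -/

section Window

/-- [folklore] `SymmetrisedDressingMatrix.abs_pmSymBm_le` with the cast `((d+1 : ℕ) : ℝ) = (d : ℝ) + 1` pushed (the comb file's shape). -/
theorem abs_pmSymBm_le' {N : ℕ} (hN : 1 ≤ N) {r : Fin (d + 1) → ℕ} (hr : r ∈ box (d + 1) N) (β : Fin (d + 1)) (p : Fin (d + 1) → ℤ)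
    (α : Fin (d + 1)) (q : Fin (d + 1) → ℤ) : |pmSymBm (toSite r) N β p α q| ≤ 1 + 4 * (((d : ℝ) + 1) * N) := by
  have h := abs_pmSymBm_le hN hr β p α q
  push_cast at h
  exact h

/-- [folklore] **THE BLOCK-MEAN WINDOW OPERATOR `Πᵀ_bm` ON REAL ONE-FORMS**: `(Πᵀ_bm g)_α(q) = Σ_{v ∈ cube} Σ_β pmSymBm ρ N β (q+v) α q · g_β(q+v)`. -/
def coProjSymAt (ρ : Fin (d + 1) → ℤ) (N : ℕ) (g : Form1 (d + 1) ℝ) : Form1 (d + 1) ℝ :=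
  fun α q => ∑ v ∈ cube (d + 1) N, ∑ β : Fin (d + 1), pmSymBm ρ N β (q + v) α q * g β (q + v)

/-- [folklore] Pointwise form of `coProjSymAt`. -/
theorem coProjSymAt_apply (ρ : Fin (d + 1) → ℤ) (N : ℕ) (g : Form1 (d + 1) ℝ) (α : Fin (d + 1)) (q : Fin (d + 1) → ℤ) :
    coProjSymAt ρ N g α q = ∑ v ∈ cube (d + 1) N, ∑ β : Fin (d + 1), pmSymBm ρ N β (q + v) α q * g β (q + v) := rfl







/-- [folklore] **SUP BOUND FOR `Πᵀ_bm`:** `|(Πᵀ_bm g)_α(q)| ≤ cWb·M` if `|g| ≤ M` on the window bonds at `q` (in-block root). -/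
theorem abs_coProjSymAt_le {N : ℕ} (hN : 1 ≤ N) {r : Fin (d + 1) → ℕ} (hr : r ∈ box (d + 1) N) (g : Form1 (d + 1) ℝ)
    (α : Fin (d + 1)) (q : Fin (d + 1) → ℤ) {M : ℝ}
    (hM : ∀ (κ : Fin (d + 1)) (v : Fin (d + 1) → ℤ), v ∈ cube (d + 1) N → |g κ (q + v)| ≤ M) :
    |coProjSymAt (toSite r) N g α q| ≤ cWb d N * M := by
  rw [coProjSymAt_apply]
  calc |∑ v ∈ cube (d + 1) N, ∑ β : Fin (d + 1), pmSymBm (toSite r) N β (q + v) α q * g β (q + v)|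
      ≤ ∑ v ∈ cube (d + 1) N, |∑ β : Fin (d + 1), pmSymBm (toSite r) N β (q + v) α q * g β (q + v)| :=
        Finset.abs_sum_le_sum_abs _ _
    _ ≤ ∑ v ∈ cube (d + 1) N, ∑ _β : Fin (d + 1), (1 + 4 * (((d : ℝ) + 1) * N)) * M :=
        Finset.sum_le_sum fun v hv => (Finset.abs_sum_le_sum_abs _ _).trans
          (Finset.sum_le_sum fun β _ => by
            rw [abs_mul]
            exact mul_le_mul (abs_pmSymBm_le' hN hr β (q + v) α q) (hM β v hv) (abs_nonneg _) (by positivity))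
    _ = cWb d N * M := by
        rw [Finset.sum_const, Finset.sum_const, Finset.card_univ, Fintype.card_fin, card_cube]
        simp only [nsmul_eq_mul]
        unfold cWb
        push_cast
        ring

/-- [folklore] **`Πᵀ_bm` IS COARSE-TRANSLATION COVARIANT**: `Πᵀ_bm (g ∘ shift (N•z)) (α, q) = (Πᵀ_bm g)(α, q + N•z)`. -/
theorem coProjSymAt_shift (ρ : Fin (d + 1) → ℤ) {N : ℕ} (hN : 1 ≤ N) (g : Form1 (d + 1) ℝ) (z : Fin (d + 1) → ℤ)
    (α : Fin (d + 1)) (q : Fin (d + 1) → ℤ) :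
    coProjSymAt ρ N (fun κ u => g κ (u + (N : ℤ) • z)) α q = coProjSymAt ρ N g α (q + (N : ℤ) • z) := by
  rw [coProjSymAt_apply, coProjSymAt_apply]
  refine Finset.sum_congr rfl fun v _ => Finset.sum_congr rfl fun β _ => ?_
  rw [add_right_comm q ((N : ℤ) • z) v, pmSymBm_shift ρ hN]

end Window

/-! ## §2 The leg dressings in window form and their identification with the comp form -/

section Legs

/-- [folklore] `Πᵀ_bm` on the FIRST leg of a kernel table (`inl` components; multiplier legs untouched). -/
def legCo₁SymAt (ρ : Fin (d + 1) → ℤ) (N : ℕ) (K : MKer (d + 1) (Fib d)) : MKer (d + 1) (Fib d) :=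
  fun x y a b =>
    match a with
    | Sum.inl α => coProjSymAt ρ N (fun α' x' => K x' y (Sum.inl α') b) α x
    | Sum.inr _ => K x y a b

/-- [folklore] `Πᵀ_bm` on the SECOND leg of a kernel table. -/
def legCo₂SymAt (ρ : Fin (d + 1) → ℤ) (N : ℕ) (K : MKer (d + 1) (Fib d)) : MKer (d + 1) (Fib d) :=
  fun x y a b =>
    match b with
    | Sum.inl β => coProjSymAt ρ N (fun β' y' => K x y' a (Sum.inl β')) β y
    | Sum.inr _ => K x y a b

variable (ρ : Fin (d + 1) → ℤ) (N : ℕ)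

/-- [folklore] Computation rule, first leg, field component. -/
theorem legCo₁SymAt_inl (K : MKer (d + 1) (Fib d)) (x y : Fin (d + 1) → ℤ) (α : Fin (d + 1)) (b : Fib d) :
    legCo₁SymAt ρ N K x y (Sum.inl α) b = coProjSymAt ρ N (fun α' x' => K x' y (Sum.inl α') b) α x := rfl

/-- [folklore] Computation rule, first leg, multiplier component. -/
theorem legCo₁SymAt_inr (K : MKer (d + 1) (Fib d)) (x y : Fin (d + 1) → ℤ) (m : Fin (d + 1)) (b : Fib d) :
    legCo₁SymAt ρ N K x y (Sum.inr m) b = K x y (Sum.inr m) b := rfl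

/-- [folklore] Computation rule, second leg, field component. -/
theorem legCo₂SymAt_inl (K : MKer (d + 1) (Fib d)) (x y : Fin (d + 1) → ℤ) (a : Fib d) (β : Fin (d + 1)) :
    legCo₂SymAt ρ N K x y a (Sum.inl β) = coProjSymAt ρ N (fun β' y' => K x y' a (Sum.inl β')) β y := rfl

/-- [folklore] Computation rule, second leg, multiplier component. -/
theorem legCo₂SymAt_inr (K : MKer (d + 1) (Fib d)) (x y : Fin (d + 1) → ℤ) (a : Fib d) (m : Fin (d + 1)) :
    legCo₂SymAt ρ N K x y a (Sum.inr m) = K x y a (Sum.inr m) := rfl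

/-- [folklore] Fibre contraction against a ROW of `piKSymBm`, field row: a windowed `pmSymBm`-sum. -/
theorem sum_piKSymBm_mul_inl (x x' : Fin (d + 1) → ℤ) (α : Fin (d + 1)) (g : Fib d → ℝ) :
    ∑ f : Fib d, piKSymBm ρ N x x' (Sum.inl α) f * g f =
      if x' - x ∈ cube (d + 1) N then ∑ β : Fin (d + 1), pmSymBm ρ N β x' α x * g (Sum.inl β) else 0 := by
  rw [Fintype.sum_sum_type]
  simp only [piKSymBm_inl_inl, piKSymBm_inl_inr, zero_mul, Finset.sum_const_zero, add_zero]
  split_ifs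
  · rfl
  · simp

/-- [folklore] Fibre contraction against a ROW of `piKSymBm`, multiplier row: the Kronecker delta. -/
theorem sum_piKSymBm_mul_inr (x x' : Fin (d + 1) → ℤ) (m : Fin (d + 1)) (g : Fib d → ℝ) :
    ∑ f : Fib d, piKSymBm ρ N x x' (Sum.inr m) f * g f = if x = x' then g (Sum.inr m) else 0 := by
  rw [Fintype.sum_sum_type]
  simp only [piKSymBm_inr_inl, piKSymBm_inr_inr, zero_mul, Finset.sum_const_zero, zero_add]
  by_cases h : x = x'
  · simp only [h, true_and, ite_mul, one_mul, zero_mul, Finset.sum_ite_eq, Finset.mem_univ, if_true]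
  · simp [h]

/-- [folklore] Fibre contraction against a COLUMN of `piKSymBm` (a row of `trK piKSymBm`), field column. -/
theorem sum_mul_piKSymBm_inl (y y' : Fin (d + 1) → ℤ) (β : Fin (d + 1)) (g : Fib d → ℝ) :
    ∑ f : Fib d, g f * piKSymBm ρ N y y' (Sum.inl β) f =
      if y' - y ∈ cube (d + 1) N then ∑ β' : Fin (d + 1), pmSymBm ρ N β' y' β y * g (Sum.inl β') else 0 := by
  rw [Fintype.sum_sum_type]
  simp only [piKSymBm_inl_inl, piKSymBm_inl_inr, mul_zero, Finset.sum_const_zero, add_zero]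
  split_ifs
  · exact Finset.sum_congr rfl fun β' _ => mul_comm _ _
  · simp

/-- [folklore] Fibre contraction against a COLUMN of `piKSymBm`, multiplier column. -/
theorem sum_mul_piKSymBm_inr (y y' : Fin (d + 1) → ℤ) (m : Fin (d + 1)) (g : Fib d → ℝ) :
    ∑ f : Fib d, g f * piKSymBm ρ N y y' (Sum.inr m) f = if y = y' then g (Sum.inr m) else 0 := by
  rw [Fintype.sum_sum_type]
  simp only [piKSymBm_inr_inl, piKSymBm_inr_inr, mul_zero, Finset.sum_const_zero, zero_add]
  by_cases h : y = y'
  · simp only [h, true_and, mul_ite, mul_one, mul_zero, Finset.sum_ite_eq, Finset.mem_univ, if_true]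
  · simp [h]

/-- [folklore] **`Πᵀ_bm` ON THE FIRST LEG IS LEFT COMPOSITION WITH `piKSymBm`**: `legCo₁SymAt ρ N K = comp (piKSymBm ρ N) K`. -/
theorem legCo₁SymAt_eq_comp (K : MKer (d + 1) (Fib d)) : legCo₁SymAt ρ N K = comp (piKSymBm ρ N) K := by
  funext x y a b
  rcases a with α | m
  · rw [legCo₁SymAt_inl, coProjSymAt_apply]
    unfold ExpKernelCalculus.comp
    simp_rw [sum_piKSymBm_mul_inl]
    rw [tsum_window]
  · rw [legCo₁SymAt_inr]
    unfold ExpKernelCalculus.comp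
    simp_rw [sum_piKSymBm_mul_inr]
    rw [tsum_point]

/-- [folklore] **`Πᵀ_bm` ON THE SECOND LEG IS RIGHT COMPOSITION WITH `trK piKSymBm`**: `legCo₂SymAt ρ N K = comp K (trK (piKSymBm ρ N))`. -/
theorem legCo₂SymAt_eq_comp (K : MKer (d + 1) (Fib d)) : legCo₂SymAt ρ N K = comp K (trK (piKSymBm ρ N)) := by
  funext x y a b
  rcases b with β | m
  · rw [legCo₂SymAt_inl, coProjSymAt_apply]
    unfold ExpKernelCalculus.comp
    simp only [trK]
    simp_rw [sum_mul_piKSymBm_inl]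
    rw [tsum_window]
  · rw [legCo₂SymAt_inr]
    unfold ExpKernelCalculus.comp
    simp only [trK]
    simp_rw [sum_mul_piKSymBm_inr]
    rw [tsum_point]

/-- [folklore] **THE COMP-FORM DRESSING IS THE TWO LEG DRESSINGS**: `dressKSymAt ρ N K = legCo₂SymAt ρ N (legCo₁SymAt ρ N K)`. -/
theorem dressKSymAt_eq_legs (K : MKer (d + 1) (Fib d)) : dressKSymAt ρ N K = legCo₂SymAt ρ N (legCo₁SymAt ρ N K) := by
  rw [legCo₂SymAt_eq_comp, legCo₁SymAt_eq_comp]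
  rfl

end Legs

/-! ## §3 Bi-localisation survives the block-mean leg dressings (same rate) -/

section LegBounds







/-- [folklore] **FIRST-LEG BLOCK-MEAN DRESSING PRESERVES BI-LOCALISATION:** `BiLoc K p q C δ ⇒ BiLoc (legCo₁SymAt ρ N K) p q (cKb·C) δ`
(in-block root `ρ = toSite r`, `1 ≤ N`, `0 ≤ δ`). -/
theorem biLoc_legCo₁SymAt {N : ℕ} (hN : 1 ≤ N) {r : Fin (d + 1) → ℕ} (hr : r ∈ box (d + 1) N)
    {K : MKer (d + 1) (Fib d)} {p q : Fin (d + 1) → ℤ} {C δ : ℝ}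
    (h : BiLoc K p q C δ) (hδ : 0 ≤ δ) : BiLoc (legCo₁SymAt (toSite r) N K) p q (cKb d N δ * C) δ := by
  have hC : 0 ≤ C := h.nonneg (Sum.inl 0)
  intro x y a b
  cases a with
  | inr m =>
    rw [legCo₁SymAt_inr]
    calc |K x y (Sum.inr m) b| ≤ C * Real.exp (-δ * (l1 (x - p) + l1 (y - q))) := h x y _ b
      _ ≤ cKb d N δ * C * Real.exp (-δ * (l1 (x - p) + l1 (y - q))) := by
          have h1 := one_le_cKb d N hδ
          have h2 : 0 ≤ C * Real.exp (-δ * (l1 (x - p) + l1 (y - q))) := by positivity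
          nlinarith
  | inl α =>
    rw [legCo₁SymAt_inl]
    have hM : ∀ (κ : Fin (d + 1)) (v : Fin (d + 1) → ℤ), v ∈ cube (d + 1) N →
        |K (x + v) y (Sum.inl κ) b| ≤ C * Real.exp (δ * (((d : ℝ) + 1) * N)) * Real.exp (-δ * (l1 (x - p) + l1 (y - q))) :=
      fun κ v hv => (h (x + v) y _ b).trans (exp_recenter_le (l1_sub_window_le x hv) hC hδ)
    calc |coProjSymAt (toSite r) N (fun α' x' => K x' y (Sum.inl α') b) α x|
        ≤ cWb d N * (C * Real.exp (δ * (((d : ℝ) + 1) * N)) * Real.exp (-δ * (l1 (x - p) + l1 (y - q)))) :=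
          abs_coProjSymAt_le hN hr _ α x hM
      _ = cKb d N δ * C * Real.exp (-δ * (l1 (x - p) + l1 (y - q))) := by
          unfold cKb
          ring

/-- [folklore] **SECOND-LEG BLOCK-MEAN DRESSING PRESERVES BI-LOCALISATION.** -/
theorem biLoc_legCo₂SymAt {N : ℕ} (hN : 1 ≤ N) {r : Fin (d + 1) → ℕ} (hr : r ∈ box (d + 1) N)
    {K : MKer (d + 1) (Fib d)} {p q : Fin (d + 1) → ℤ} {C δ : ℝ}
    (h : BiLoc K p q C δ) (hδ : 0 ≤ δ) : BiLoc (legCo₂SymAt (toSite r) N K) p q (cKb d N δ * C) δ := by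
  have hC : 0 ≤ C := h.nonneg (Sum.inl 0)
  intro x y a b
  cases b with
  | inr m =>
    rw [legCo₂SymAt_inr]
    calc |K x y a (Sum.inr m)| ≤ C * Real.exp (-δ * (l1 (x - p) + l1 (y - q))) := h x y a _
      _ ≤ cKb d N δ * C * Real.exp (-δ * (l1 (x - p) + l1 (y - q))) := by
          have h1 := one_le_cKb d N hδ
          have h2 : 0 ≤ C * Real.exp (-δ * (l1 (x - p) + l1 (y - q))) := by positivity
          nlinarith
  | inl β =>
    rw [legCo₂SymAt_inl]
    have hM : ∀ (κ : Fin (d + 1)) (v : Fin (d + 1) → ℤ), v ∈ cube (d + 1) N →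
        |K x (y + v) a (Sum.inl κ)| ≤ C * Real.exp (δ * (((d : ℝ) + 1) * N)) * Real.exp (-δ * (l1 (y - q) + l1 (x - p))) := by
      intro κ v hv
      have h1 := h x (y + v) a (Sum.inl κ)
      rw [add_comm (l1 (x - p)) (l1 (y + v - q))] at h1
      exact h1.trans (exp_recenter_le (l1_sub_window_le y hv) hC hδ)
    calc |coProjSymAt (toSite r) N (fun β' y' => K x y' a (Sum.inl β')) β y|
        ≤ cWb d N * (C * Real.exp (δ * (((d : ℝ) + 1) * N)) * Real.exp (-δ * (l1 (y - q) + l1 (x - p)))) :=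
          abs_coProjSymAt_le hN hr _ β y hM
      _ = cKb d N δ * C * Real.exp (-δ * (l1 (x - p) + l1 (y - q))) := by
          unfold cKb
          rw [add_comm (l1 (y - q))]
          ring

/-- [folklore] **THE BLOCK-MEAN KERNEL DRESSING PRESERVES BI-LOCALISATION:** `BiLoc K p q C δ ⇒ BiLoc (dressKSymAt ρ N K) p q (cKb²·C) δ`. -/
theorem biLoc_dressKSymAt {N : ℕ} (hN : 1 ≤ N) {r : Fin (d + 1) → ℕ} (hr : r ∈ box (d + 1) N)
    {K : MKer (d + 1) (Fib d)} {p q : Fin (d + 1) → ℤ} {C δ : ℝ}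
    (h : BiLoc K p q C δ) (hδ : 0 ≤ δ) : BiLoc (dressKSymAt (toSite r) N K) p q (cKb d N δ * (cKb d N δ * C)) δ := by
  rw [dressKSymAt_eq_legs]
  exact biLoc_legCo₂SymAt hN hr (biLoc_legCo₁SymAt hN hr h hδ) hδ

end LegBounds

end

end Summit.QuantumFields.BalabanUV.Beta.SymmetrisedDressingLegs
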